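import Mathlib.CategoryTheory.Galois.EssSurj
import Literature.AnabelianGeometry.Anabelioids.QuotientAnabelioid
import Literature.AnabelianGeometry.Anabelioids.FiberFunctorUnique

/-!
# `π₁(B(Π/N)) = Π/N`: the fundamental group of a quotient anabelioid — proof

[SGA1, Exp. V §5 (5.8–5.11: the Galois correspondence)] and Mochizuki, *Semi-graphs of
anabelioids*, Publ. RIMS **42** (2006), Def. 2.3 / Ex. 2.8 p. 31 [cite: MochizukiSemiAnbd2006,
Ex. 2.8 p.31].  For a connected anabelioid `X` with basepoint `F` and an OPEN NORMAL subgroup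
`N ≤ Π := Aut F`, the quotient anabelioid `B(Π/N) ⊆ X` (`QuotientAnabelioid.lean`: the objects on
whose fibre `N` acts trivially) satisfies:

* `exists_quotientObj` — it contains an object `A₀` with `F(A₀) ≅ Π/N` as `Π`-sets (Mathlib's
  `exists_lift_of_quotient_openSubgroup`, moved to an arbitrary universe of basepoints along
  `FintypeCat.uSwitch`);
* `ker_pi1Map_fixedι` — `Ker(π₁(X, F) → π₁(B(Π/N), ι ∘ F)) = N`;
* `pi1Map_fixedι_surjective` — `π₁(X, F) → π₁(B(Π/N), ι ∘ F)` is surjective (an automorphism of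
  `ι ⋙ F` is determined by its value at the base point of `F(A₀)`, through the maps `A₀ → B`,
  `B ∈ B(Π/N)`, which the fullness of `X → (Aut F)-FinSets` provides), hence `isPi1Epi_fixedι`;
* `nonempty_quotient_mulEquiv_aut_fixedι` — `Π/N ≃ π₁(B(Π/N), ι ∘ F)`;
* `finite_aut_fixed_and_card` — at EVERY basepoint, `π₁(B(Π/N))` is finite of order `[Π : N]`.

Proof-only companion of `QuotientAnabelioid.lean`; classical.  The coset bookkeeping in
`exists_quotientObj` is adapted from `ProSigmaProofs.proSigmaObj_of_openNormal`.
-/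

namespace Literature.AnabelianGeometry.Anabelioids

open CategoryTheory CategoryTheory.Limits CategoryTheory.PreGaloisCategory

universe w w' v₁ v₂ u₁ u₂

/-! ### Moving the basepoint along a fully faithful functor of finite sets -/

section Whisker

variable {X : Type u₁} [Category.{v₁} X] {Y : Type u₂} [Category.{v₂} Y]

/-- The components of a whiskered automorphism of a basepoint.
[cite: MochizukiGeoAn2004, Def. 1.1.2(ii) p.10] -/
theorem autEquivAutWhiskerRight_hom_app (F : X ⥤ FintypeCat.{w})
    {G : FintypeCat.{w} ⥤ FintypeCat.{w'}} (hG : G.FullyFaithful) (σ : Aut F) (A : X) :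
    (autEquivAutWhiskerRight F hG σ).hom.app A = G.map (σ.hom.app A) := rfl

/-- `π₁(-)` commutes with moving the basepoint along a fully faithful `G`.
[cite: MochizukiGeoAn2004, Def. 1.1.2(ii) p.10] -/
theorem pi1Map_autEquivAutWhiskerRight (P : Y ⥤ X) (F : X ⥤ FintypeCat.{w})
    {G : FintypeCat.{w} ⥤ FintypeCat.{w'}} (hG : G.FullyFaithful) (σ : Aut F) :
    pi1Map P (F ⋙ G) (autEquivAutWhiskerRight F hG σ) =
      autEquivAutWhiskerRight (P ⋙ F) hG (pi1Map P F σ) := rfl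

end Whisker

/-! ### The object `A₀` with `F(A₀) ≅ Π/N` -/

section QuotObj

variable {X : Type u₁} [Category.{v₁} X] [GaloisCategory X]

/-- `A₀` in the universe in which Mathlib's essential-surjectivity theorem is stated.
[cite: SGA1, Exp. V §5] -/
private theorem exists_quotientObj_aux (F : X ⥤ FintypeCat.{u₁}) [FiberFunctor F]
    (N : Subgroup (Aut F)) (hNo : IsOpen (N : Set (Aut F))) [hNn : N.Normal] :
    ∃ (A₀ : X) (y₀ : F.obj A₀), fixedObj F N A₀ ∧
      (∀ σ : Aut F, σ.hom.app A₀ y₀ = y₀ ↔ σ ∈ N) ∧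
      ∀ y : F.obj A₀, ∃ σ : Aut F, σ.hom.app A₀ y₀ = y := by
  classical
  haveI : Finite (Aut F ⧸ N) := N.quotient_finite_of_isOpen hNo
  letI : Fintype (Aut F ⧸ N) := Fintype.ofFinite _
  obtain ⟨A₀, ⟨u⟩⟩ := exists_lift_of_quotient_openSubgroup (F := F) ⟨N, hNo⟩
  -- adapted from `ProSigmaProofs.proSigmaObj_of_openNormal`
  let u' : F.obj A₀ ≅ FintypeCat.of (Aut F ⧸ N) := (Action.forget _ _).mapIso u
  have hnat : ∀ (σ : Aut F) (y : F.obj A₀), u'.hom (σ.hom.app A₀ y) = σ • u'.hom y :=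
    fun σ y => ConcreteCategory.congr_hom (u.hom.comm σ) y
  have hinj : Function.Injective u'.hom := fun y₁ y₂ h => by
    simpa [FintypeCat.hom_inv_id_apply] using congrArg u'.inv h
  let y₀ : F.obj A₀ := u'.inv ((1 : Aut F) : Aut F ⧸ N)
  have hy₀ : u'.hom y₀ = ((1 : Aut F) : Aut F ⧸ N) := FintypeCat.inv_hom_id_apply u' _
  refine ⟨A₀, y₀, fun σ hσ => ?_, fun σ => ?_, fun y => ?_⟩
  · ext y
    apply hinj
    obtain ⟨g, hg⟩ := QuotientGroup.mk_surjective (u'.hom y)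
    rw [hnat, FintypeCat.id_apply, ← hg, MulAction.Quotient.smul_mk, smul_eq_mul, QuotientGroup.eq]
    have : g⁻¹ * σ⁻¹ * g⁻¹⁻¹ ∈ N := hNn.conj_mem _ (N.inv_mem hσ) g⁻¹
    simpa only [mul_inv_rev, inv_inv, mul_assoc] using this
  · constructor
    · intro h
      have h' := congrArg u'.hom h
      rw [hnat, hy₀, MulAction.Quotient.smul_mk, smul_eq_mul, mul_one, QuotientGroup.mk_one,
        QuotientGroup.eq_one_iff] at h'
      exact h'
    · intro hσ
      apply hinj
      rw [hnat, hy₀, MulAction.Quotient.smul_mk, smul_eq_mul, mul_one, QuotientGroup.mk_one,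
        QuotientGroup.eq_one_iff]
      exact hσ
  · obtain ⟨g, hg⟩ := QuotientGroup.mk_surjective (u'.hom y)
    refine ⟨g, hinj ?_⟩
    rw [hnat, hy₀, ← hg, MulAction.Quotient.smul_mk, smul_eq_mul, mul_one]

/-- **`B(Π/N)` contains the `Π`-set `Π/N`**: for `N ≤ Π = Aut F` open and normal there is an
object `A₀ ∈ B(Π/N)` and a point `y₀ ∈ F(A₀)` with stabiliser exactly `N` and transitive
`Π`-action ([SGA1] V §5; Mathlib's `exists_lift_of_quotient_openSubgroup`, at a basepoint valued
in any universe). [cite: SGA1, Exp. V §5] -/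
theorem exists_quotientObj (F : X ⥤ FintypeCat.{w}) [FiberFunctor F] (N : Subgroup (Aut F))
    (hNo : IsOpen (N : Set (Aut F))) [hNn : N.Normal] :
    ∃ (A₀ : X) (y₀ : F.obj A₀), fixedObj F N A₀ ∧
      (∀ σ : Aut F, σ.hom.app A₀ y₀ = y₀ ↔ σ ∈ N) ∧
      ∀ y : F.obj A₀, ∃ σ : Aut F, σ.hom.app A₀ y₀ = y := by
  let G := FintypeCat.uSwitch.{w, u₁}
  let hG : G.FullyFaithful := Functor.FullyFaithful.ofFullyFaithful G
  let e := autEquivAutWhiskerRight F hG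
  let N₁ : Subgroup (Aut (F ⋙ G)) := N.map e.toMulEquiv.toMonoidHom
  have hN₁o : IsOpen (N₁ : Set (Aut (F ⋙ G))) := by
    rw [Subgroup.coe_map]
    exact e.toHomeomorph.isOpenMap _ hNo
  haveI : N₁.Normal := hNn.map e.toMulEquiv.toMonoidHom e.surjective
  have hmem : ∀ σ : Aut F, e σ ∈ N₁ ↔ σ ∈ N := fun σ =>
    Subgroup.mem_map_iff_mem (f := e.toMulEquiv.toMonoidHom) e.injective
  obtain ⟨A₀, y₁, hfix, hstab, htrans⟩ := exists_quotientObj_aux (F ⋙ G) N₁ hN₁o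
  let ε := (F.obj A₀).uSwitchEquiv
  have hε : ∀ (σ : Aut F) (y : (F ⋙ G).obj A₀),
      σ.hom.app A₀ (ε y) = ε ((e σ).hom.app A₀ y) := fun σ y =>
    FintypeCat.uSwitchEquiv_naturality (σ.hom.app A₀) y
  refine ⟨A₀, ε y₁, fun σ hσ => ?_, fun σ => ?_, fun y => ?_⟩
  · have h1 : G.map (σ.hom.app A₀) = G.map (𝟙 _) := by
      rw [G.map_id]
      exact hfix _ ((hmem σ).mpr hσ)
    exact G.map_injective h1
  · rw [hε, ε.apply_eq_iff_eq]
    exact (hstab (e σ)).trans (hmem σ)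
  · obtain ⟨σ₁, hσ₁⟩ := htrans (ε.symm y)
    refine ⟨e.symm σ₁, ?_⟩
    rw [hε, ContinuousMulEquiv.apply_symm_apply, hσ₁, Equiv.apply_symm_apply]

end QuotObj

/-! ### `π₁(B(Π/N), ι ∘ F) = Π/N` -/

section Pi1

variable {X : Type u₁} [Category.{v₁} X] [GaloisCategory X] (F : X ⥤ FintypeCat.{w})
  [FiberFunctor F] (N : Subgroup (Aut F)) (hNo : IsOpen (N : Set (Aut F))) [hNn : N.Normal]

include hNo in
/-- **`Ker(π₁(X, F) → π₁(B(Π/N), ι ∘ F)) = N`** for `N` open normal.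
[cite: MochizukiSemiAnbd2006, Ex. 2.8 p.31] -/
theorem ker_pi1Map_fixedι : (pi1Map (fixedObj F N).ι F).ker = N := by
  obtain ⟨A₀, y₀, hA₀, hstab, -⟩ := exists_quotientObj F N hNo
  ext σ
  rw [MonoidHom.mem_ker]
  constructor
  · intro h
    have hA : σ.hom.app A₀ = 𝟙 _ :=
      congrArg (fun τ : Aut ((fixedObj F N).ι ⋙ F) => τ.hom.app ⟨A₀, hA₀⟩) h
    exact (hstab σ).mp (by rw [hA]; rfl)
  · intro hσ
    refine Iso.ext ?_
    ext B x
    simp only [pi1Map_hom_app, ObjectProperty.ι_obj, B.property σ hσ]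
    rfl

include hNo in
/-- **`π₁(X, F) → π₁(B(Π/N), ι ∘ F)` is surjective** for `N` open normal: an automorphism `τ`
of `ι ⋙ F` agrees with `g ∈ Π` chosen so that `g · y₀ = τ(y₀)`, because through every point `x`
of `F(B)`, `B ∈ B(Π/N)`, passes a morphism `A₀ → B` mapping `y₀ ↦ x` (fullness of
`X → Π-FinSets`; the stabiliser `N` of `y₀` fixes `x`). [cite: MochizukiSemiAnbd2006, Ex. 2.8 p.31] -/
theorem pi1Map_fixedι_surjective : Function.Surjective (pi1Map (fixedObj F N).ι F) := by
  classical
  obtain ⟨A₀, y₀, hA₀, hstab, htrans⟩ := exists_quotientObj F N hNo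
  choose s hs using htrans
  -- two automorphisms agreeing at `y₀` agree on every fibre of `B(Π/N)`
  have hwd : ∀ (B : Fixed F N) (x : F.obj B.obj) (σ₁ σ₂ : Aut F),
      σ₁.hom.app A₀ y₀ = σ₂.hom.app A₀ y₀ → σ₁.hom.app B.obj x = σ₂.hom.app B.obj x := by
    intro B x σ₁ σ₂ h
    have hmem : σ₁⁻¹ * σ₂ ∈ N := (hstab _).mp (by
      change σ₁⁻¹.hom.app A₀ (σ₂.hom.app A₀ y₀) = y₀
      rw [← h]
      change (σ₁⁻¹ * σ₁).hom.app A₀ y₀ = y₀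
      rw [inv_mul_cancel]
      rfl)
    have h1 : (σ₁⁻¹ * σ₂).hom.app B.obj = 𝟙 _ := B.property _ hmem
    calc σ₁.hom.app B.obj x = σ₁.hom.app B.obj ((σ₁⁻¹ * σ₂).hom.app B.obj x) := by rw [h1]; rfl
      _ = (σ₁ * (σ₁⁻¹ * σ₂)).hom.app B.obj x := rfl
      _ = σ₂.hom.app B.obj x := by rw [mul_inv_cancel_left]
  -- through every point passes a morphism from `A₀`
  have hψ : ∀ (B : Fixed F N) (x : F.obj B.obj), ∃ ψ : A₀ ⟶ B.obj, F.map ψ y₀ = x := by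
    intro B x
    let q : (functorToAction F).obj A₀ ⟶ (functorToAction F).obj B.obj :=
      { hom := FintypeCat.homMk fun y => (s y).hom.app B.obj x
        comm := fun σ => by
          ext y
          change (s (σ.hom.app A₀ y)).hom.app B.obj x = σ.hom.app B.obj ((s y).hom.app B.obj x)
          have : (s (σ.hom.app A₀ y)).hom.app A₀ y₀ = (σ * s y).hom.app A₀ y₀ := by
            rw [hs]
            change _ = σ.hom.app A₀ ((s y).hom.app A₀ y₀)
            rw [hs]
          rw [hwd B x _ _ this]
          rfl }
    refine ⟨(functorToAction F).preimage q, ?_⟩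
    have hmap : F.map ((functorToAction F).preimage q) = q.hom := by
      have := congrArg Action.Hom.hom ((functorToAction F).map_preimage q)
      simp only [functorToAction_map] at this
      exact this
    rw [hmap]
    change (s y₀).hom.app B.obj x = x
    have : (s y₀).hom.app A₀ y₀ = (1 : Aut F).hom.app A₀ y₀ := by rw [hs]; rfl
    rw [hwd B x _ _ this]
    rfl
  -- the candidate preimage of `τ`
  intro τ
  refine ⟨s (τ.hom.app ⟨A₀, hA₀⟩ y₀), ?_⟩
  refine Iso.ext ?_
  ext B x
  obtain ⟨ψ, hψx⟩ := hψ B x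
  have hnat := NatTrans.naturality_apply τ.hom
    (ObjectProperty.homMk ψ : (⟨A₀, hA₀⟩ : Fixed F N) ⟶ B) y₀
  change τ.hom.app B (F.map ψ y₀) = F.map ψ (τ.hom.app ⟨A₀, hA₀⟩ y₀) at hnat
  rw [pi1Map_hom_app]
  change (s (τ.hom.app ⟨A₀, hA₀⟩ y₀)).hom.app B.obj x = τ.hom.app B x
  rw [← hψx, hnat]
  have h2 := NatTrans.naturality_apply (s (τ.hom.app ⟨A₀, hA₀⟩ y₀)).hom ψ y₀
  rw [hs] at h2
  exact h2

include hNo in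
/-- **The quotient morphism `X → B(Π/N)` is a `π₁`-epimorphism** (at every basepoint).
[cite: MochizukiSemiAnbd2006, Ex. 2.8 p.31] -/
theorem isPi1Epi_fixedι : IsPi1Epi (fixedObj F N).ι := by
  let G := FintypeCat.uSwitch.{w, v₁}
  let hG : G.FullyFaithful := Functor.FullyFaithful.ofFullyFaithful G
  rw [isPi1Epi_iff_surjective _ (F ⋙ G)]
  intro τ
  obtain ⟨σ, hσ⟩ := pi1Map_fixedι_surjective F N hNo
    ((autEquivAutWhiskerRight ((fixedObj F N).ι ⋙ F) hG).symm τ)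
  refine ⟨autEquivAutWhiskerRight F hG σ, ?_⟩
  rw [pi1Map_autEquivAutWhiskerRight, hσ, ContinuousMulEquiv.apply_symm_apply]

include hNo in
/-- **`Π/N ≃ π₁(B(Π/N), ι ∘ F)`** for `N` open normal. [cite: MochizukiSemiAnbd2006, Ex. 2.8 p.31] -/
theorem nonempty_quotient_mulEquiv_aut_fixedι :
    Nonempty (Aut F ⧸ N ≃* Aut ((fixedObj F N).ι ⋙ F)) :=
  ⟨(QuotientGroup.quotientMulEquivOfEq (ker_pi1Map_fixedι F N hNo).symm).trans
    (QuotientGroup.quotientKerEquivOfSurjective _ (pi1Map_fixedι_surjective F N hNo))⟩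

include hNo in
/-- **`π₁(B(Π/N))` is finite of order `[Π : N]`, at every basepoint** (`N` open normal; any two
basepoints have isomorphic fundamental groups). [cite: MochizukiSemiAnbd2006, Ex. 2.8 p.31] -/
theorem finite_aut_fixed_and_card (F' : Fixed F N ⥤ FintypeCat.{v₁}) [FiberFunctor F'] :
    Finite (Aut F') ∧ Nat.card (Aut F') = N.index := by
  let G := FintypeCat.uSwitch.{w, v₁}
  let hG : G.FullyFaithful := Functor.FullyFaithful.ofFullyFaithful G
  obtain ⟨e₁⟩ := nonempty_iso_of_fiberFunctor F' (((fixedObj F N).ι ⋙ F) ⋙ G)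
  let e₂ := (autEquivAutWhiskerRight ((fixedObj F N).ι ⋙ F) hG).symm
  obtain ⟨e₃⟩ := nonempty_quotient_mulEquiv_aut_fixedι F N hNo
  let e : Aut F' ≃ Aut F ⧸ N := (e₁.conjAut.toEquiv.trans e₂.toEquiv).trans e₃.symm.toEquiv
  haveI : Finite (Aut F ⧸ N) := N.quotient_finite_of_isOpen hNo
  exact ⟨Finite.of_equiv _ e.symm, by rw [Nat.card_congr e]; rfl⟩

end Pi1

end Literature.AnabelianGeometry.Anabelioids
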